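import Literature.AlgebraicGeometry.ShimuraVarieties.UnitaryCurveSpecialPairCMStructure
import Literature.AlgebraicGeometry.ShimuraVarieties.UnitaryCurveSpecialPairRecipMatrix
import Literature.AlgebraicGeometry.ShimuraVarieties.UnitaryCurveReciprocityTwistInvariance
import Literature.AlgebraicGeometry.ShimuraVarieties.UnitaryAuxiliarySpecialPair
import Literature.AlgebraicGeometry.ShimuraVarieties.UnitaryAuxiliaryReflexArtinNorm
import Literature.AlgebraicGeometry.ShimuraVarieties.UnitaryAuxiliaryReflexArtinSurjective
import Literature.AlgebraicGeometry.ShimuraVarieties.UnitaryShimuraComplexGaloisDatumAssembly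
import Literature.AlgebraicGeometry.ShimuraVarieties.UnitaryShimuraCurveHeckeDescent
import Literature.AlgebraicGeometry.ShimuraVarieties.UnitaryAnisotropicLineFrame
import Literature.AlgebraicGeometry.ModuliOfAbelianVarieties.SiegelShimuraSetDissection
import Literature.NumberTheory.NumberFields.RayClassFieldIdelic
import Literature.NumberTheory.NumberFields.FiniteIdeleArtinKernel
import Literature.NumberTheory.NumberFields.FiniteIdeleCongruenceSubgroupBasis
import Literature.NumberTheory.ComplexMultiplication.ArtinLiftAlgebra
import Literature.NumberTheory.ComplexMultiplication.ReflexNormIdelesNormRelation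
import HarnessLib

/-!
# Special-pair reciprocity on the unitary Shimura CURVE, transported through the slice `b = ũ_V(·, 1)` of the Hodge embedding
# ([Milne 2005] Def. 12.8 (60)–(62) at the special pair of [Deligne 1971] 5.11; the field over which the torus coordinate is absorbed)

Topic `AlgebraicGeometry/ShimuraVarieties`; namespace `Literature.AlgebraicGeometry.ShimuraVarieties.UnitaryCurve.AuxV` (§1, §3) and
`…ShimuraVarieties.UnitaryCanonicalModel` (§0, §2).  THEOREMS ONLY (no definition, no named fact, no instance, no `sorry`; net Literature
debt 0).  Cell `hodgecm-mathlib` (D-0151), FLOOR 0, P6 «MOD programme», door (E) of `stub_RGD`, organ **E3R** — the head file; inputs ★ FILE A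
`UnitaryCurveSpecialPairCMStructure`, ★ FILE B `UnitaryCurveSpecialPairRecipMatrix`, ★ FILE D `UnitaryCurveReciprocityTwistInvariance`.
`--supports stmt-HodgeConjecture-24832`, count-neutral; HC_CM is proved only modulo the printed citations until rung 0 closes.

THE POINT.  The E-line chart `AuxChartGS` (`Cruxes/HLiu418/Lines/F0_P6a_PELWitnessE.lean` §2) maps the unitary Shimura curve `Sh_{Kc}(U(J⋆))(ℂ)`
into the `ℚ`-structure points of a Siegel fine moduli scheme through the SLICE `b = ũ_V(·, 1)` of [RapoportSmithlingZhang2020Diagonal] (3.3)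
`G̃ ≅ Z^ℚ × U(V) → GU(V) ↪ GSp`, and asks (`f_recip`) that at the special points `[ι₁ w]`, `w ∈ F²`, the Galois action follow the UNITARY
reciprocity factor `d = r_w(s)` ([Milne2005ShimuraVarieties] (62) for `T = U(F·w′) × U(F·w)`, `μ = [ῑ₁] − [ι₁]` on the second factor).  Siegel
reciprocity (62) at the CM special pair `(c_B, J(ι₁w))` of the frame `B = (w′ | w)` ([Deligne1971TravauxShimura] 5.11) gives instead
`σ • [J, b(a)] = [J, r(s♯)·b(a)]` with `r(s♯) = ũ_V(d♯, t)`, `t = N_{E♯,Φ}(s♯) ∈ T₀(F)(𝔸_f)` a SCALAR (★ FILE B), `s♯` an idèle of the reflex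
compositum `E♯ = ι₁(F)·E*(Φ)`.  This file absorbs the scalar: `t` lies in `K_δ(N)` as soon as `s♯` lies in a congruence subgroup `W_𝔪`
of `E♯` (§1, continuity of the reflex norm + Neukirch VI (1.8)), and `s♯` may be CHOSEN in `W_𝔪` as soon as `σ` fixes the RAY CLASS FIELD
`C_𝔪(E♯)` (§2, class field theory: `[s, E♯]|_{C_𝔪} = 1 ↔ s ∈ E♯^×·W_𝔪`, and a principal finite idèle is an Artin correspondent of the
identity for a totally complex field).  HEAD (§3) `exists_sliceField_siegelRecipDatum`: there is a number field `E₀ ⊇ E♯` (inside `ℂ`) such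
that for every `σ ∈ Aut(ℂ/E₀)`, every `F`-idèle `s` with `art_F(s) = σ|` along `ι₁`, every special `w`, twist `d = r_w(s)` and `a`, the
Siegel reciprocity INPUT DATA `(c, Φ′, E♯, s♯, r)` of ★ `SiegelRationalModel.IsCanonical` exist with `[J(ι₁w), r·b(a)]_{K_δ(N)} = [J(ι₁w), b(d♯·a)]_{K_δ(N)}`
and `[ι₁w, d·a]_K = [ι₁w, d♯·a]_K` for every `K` (★ FILE D) — so that the E-line's GEN closes `f_recip` from the carrier reciprocity of
the Siegel fine moduli scheme (E3R-S) with `Fᵢ₀ ⊇ E₀`.  The special-pair property of E2's complex structure `J` enters BY VALUE (`hJsp`).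

* §0 `isArtinCorrespondent_refl_of_ideleArtinMap_eq_one`, `IsArtinCorrespondent.mul_unitEmbedding_inv` — principal finite idèles are
  Artin correspondents of the identity (totally complex fields).
* §1 `exists_conductor_one_mk_reflexNorm_mem` — the conductor `𝔪` with `ũ_V(1, N_{E,Φ}(u)) ∈ K_δ(N)` for `u ∈ W_𝔪`.
* §2 `exists_sliceField_forall_isArtinCorrespondent_mem` — the slice field `E₀ ⊇ C_𝔪(E)`: every Artin correspondent of a `σ` fixing `E₀`
  lies in `E^× · W_𝔪`, hence `σ` has a correspondent IN `W_𝔪`.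
* §3 HEAD `exists_sliceField_siegelRecipDatum` (curve, `n = 2`).
* §3 ED. 2 `exists_sliceField_siegelRecipDatum_explicit` — the same head with the Siegel class identity in the EXPLICIT form
  `∃ t ∈ K_δ(N), r · ũ_V(a,1) = ũ_V(d♯·a,1) · t` (rational witness `γ = 1`), which the Σ-GAL organs ★ (K-b) `SiegelConjugationHomReindex` ∕
  ★ (K-c) `SiegelAdelicCongrFrameTransport` of `stub_E6` consume (`g₀ = r` commutes with the `𝒪_F`-action); the ED. 1 head is its corollary.

## References
* [Milne2005ShimuraVarieties] J. S. Milne, *Introduction to Shimura varieties* (2005), Def. 12.5 p. 113, Def. 12.8 (59)–(62) p. 114, Ex. 12.4 (b) p. 112.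
* [Deligne1971TravauxShimura] P. Deligne, *Travaux de Shimura* (1971), 3.9–3.10 p. 140, 4.18 p. 150, 5.11 p. 158.
* [RapoportSmithlingZhang2020Diagonal] M. Rapoport, B. Smithling, W. Zhang, Compos. Math. 156 (2020), Remark 3.1–3.2, (3.3), (3.10), Prop. 3.7.
* [NeukirchANT1999] J. Neukirch, *Algebraic Number Theory* (1999), Ch. VI §1 (1.8), §6 (6.2), §7 (7.1).
* [Shimura1998] G. Shimura, *Abelian Varieties with Complex Multiplication and Modular Functions* (1998), §18.3 p. 122, §18.6 p. 128.
-/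

set_option autoImplicit false

noncomputable section

open Matrix NumberField IsDedekindDomain
open scoped TensorProduct

/-! ### §0. Principal finite idèles are Artin correspondents of the identity -/

namespace Literature.AlgebraicGeometry.ShimuraVarieties

namespace UnitaryCanonicalModel

open Literature.NumberTheory.GaloisRepresentations Literature.NumberTheory.NumberFields

variable (L : Type) [Field L] [NumberField L]

/-- **A finite idèle killed by the Artin map corresponds to the identity of `ℂ`**: if `[(1_∞, k), L] = 1` then `(id, k)` is an
Artin-correspondent pair along any `τ` (`γ = 1` along any `L`-embedding `L̄ → ℂ`; [Milne2005ShimuraVarieties] (59): `art(k) = 1`).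
[cite: Milne2005ShimuraVarieties, (59) p. 107] -/
theorem isArtinCorrespondent_refl_of_ideleArtinMap_eq_one (τ : L →+* ℂ) {k : (FiniteAdeleRing (𝓞 L) L)ˣ}
    (hk : ideleArtinMap L (Units.map (MonoidHom.inr (InfiniteAdeleRing L) (FiniteAdeleRing (𝓞 L) L) :
      FiniteAdeleRing (𝓞 L) L →* AdeleRing (𝓞 L) L) k) = 1) :
    IsArtinCorrespondent L τ k (RingEquiv.refl ℂ) := by
  letI : Algebra L ℂ := τ.toAlgebra
  refine ⟨IsAlgClosed.lift (R := L) (M := ℂ) (S := AlgebraicClosure L), 1, fun x => ?_, ?_⟩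
  · simp [Field.absoluteGaloisGroup.toAlgEquiv]
  · have h1 : (isGlobalReciprocitySystem_artinMap L).theta (finiteIdeleClass L k) = 1 := by
      rw [finiteIdeleClass, ← ideleArtinMap_apply]
      exact hk
    rw [h1, map_one, inv_one]

/-- **Principal finite idèles correspond to the identity** for a totally complex `L` (every CM field): `[(1_∞, (x)), L] = 1`
(★ `ideleArtinMap_eq_one_of_mem_closure_range_unitEmbedding`; [Shimura1998] §18.3 «`[x, k] = id` for `x ∈ k^×`», the archimedean
components being connected). [cite: Shimura1998, §18.3 p. 122 and §19.10 p. 135] [cite: Milne2005ShimuraVarieties, (59) p. 107] -/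
theorem isArtinCorrespondent_unitEmbedding_refl [IsTotallyComplex L] (τ : L →+* ℂ) (x : Lˣ) :
    IsArtinCorrespondent L τ (FiniteAdeleRing.unitEmbedding (𝓞 L) L x) (RingEquiv.refl ℂ) :=
  isArtinCorrespondent_refl_of_ideleArtinMap_eq_one L τ
    (ideleArtinMap_eq_one_of_mem_closure_range_unitEmbedding L _ (subset_closure ⟨x, rfl⟩))

/-- **Changing an Artin correspondent by a principal finite idèle**: if `s ↔ σ` then `s·(x)⁻¹ ↔ σ` (`L` totally complex).
[cite: Milne2005ShimuraVarieties, (59) p. 107] [cite: Shimura1998, §18.3 p. 122] -/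
theorem IsArtinCorrespondent.mul_unitEmbedding_inv [IsTotallyComplex L] (τ : L →+* ℂ) {s : (FiniteAdeleRing (𝓞 L) L)ˣ}
    {σ : ℂ ≃+* ℂ} (hs : IsArtinCorrespondent L τ s σ) (x : Lˣ) :
    IsArtinCorrespondent L τ (s * (FiniteAdeleRing.unitEmbedding (𝓞 L) L x)⁻¹) σ := by
  have h := hs.mul τ (isArtinCorrespondent_unitEmbedding_refl L τ x⁻¹)
  rw [map_inv] at h
  have hσ : σ * RingEquiv.refl ℂ = σ := mul_one σ
  rwa [hσ] at h

end UnitaryCanonicalModel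

/-! ### §1. The conductor: `ũ_V(1, N_{E,Φ}(u)) ∈ K_δ(N)` on a congruence subgroup -/

namespace UnitaryCurve

namespace AuxV

open Literature.AlgebraicGeometry.ModuliOfAbelianVarieties
open Literature.NumberTheory.ComplexMultiplication (traceField reflexNormFiniteIdele continuous_reflexNormFiniteIdele)
open Literature.AlgebraicGeometry.Motives (CMType)
open Literature.NumberTheory.Automorphic Literature.NumberTheory.Automorphic.UnitaryGroup
open Literature.NumberTheory.NumberFields (IdeleAction.congruenceUnits IdeleAction.exists_congruenceUnits_le_of_isOpen)
open Literature.AlgebraicGeometry.ShimuraVarieties.UnitaryCanonicalModel.Aux (torusFinAdelic reflexNormFiniteIdele_mem_torusFinAdelic_of_le)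

section Conductor

variable {L : Type} [Field L] [NumberField L] [IsCMField L] {M : Type} [Field M] [NumberField M] [IsCMField M]
  {j : L →+* M} {n : ℕ} {H : Matrix (Fin n) (Fin n) L} {ξ : M} {g : ℕ} {δ : Fin g → ℕ}

/-- **THE CONDUCTOR OF THE SCALAR.**  For the symplectic frame `Fr` of `(V_M, ψ_V)`, a CM type `Φ` of `M`, a number field `E ⊆ ℂ` containing
`E*(Φ)` and a level `N ≥ 1` there is an ideal `𝔪 ≠ 0` of `𝓞_E` such that for every finite idèle `u` of `E` in the congruence subgroup
`W_𝔪 = {u | u_v ∈ 𝓞_v^×, u_v ≡ 1 mod 𝔪}` (★ `IdeleAction.congruenceUnits`) the SCALAR `ũ_V(1, N_{E,Φ}(u))` lies in the principal level `K_δ(N)`: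
the reflex norm is continuous ([MilneCM2006] I Rem. 1.25; ★ `continuous_reflexNormFiniteIdele`), `{t | ũ_V(1, t) ∈ K_δ(N)}` is open (★
`isOpen_setOf_one_mk_mem_auxLevelV`), and open subgroups of `(𝔸_{E,f})^×` contain congruence subgroups ([NeukirchANT1999] VI (1.8); ★
`exists_congruenceUnits_le_of_isOpen`).  Independent of the special point and of the adelic translate — scalars commute with `U(H)(𝔸_f)`.
[cite: NeukirchANT1999, Ch. VI §1 Prop. (1.8)] [cite: MilneCM2006, Ch. I §1 Rem. 1.25] [cite: Deligne1971TravauxShimura, 3.9–3.10 p. 140] -/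
theorem exists_conductor_one_mk_reflexNorm_mem (Fr : SymplecticFrameV M j H ξ g δ) (Φ : CMType M) (E : IntermediateField ℚ ℂ)
    [NumberField ↥E] (hE : traceField Φ ≤ E) {N : ℕ} (hN : N ≠ 0) :
    ∃ 𝔪 : Ideal (𝓞 ↥E), 𝔪 ≠ ⊥ ∧ ∀ u : (FiniteAdeleRing (𝓞 ↥E) ↥E)ˣ, u ∈ IdeleAction.congruenceUnits (K := ↥E) 𝔪 →
      auxToGspFinV Fr (1, ⟨reflexNormFiniteIdele M Φ E u, reflexNormFiniteIdele_mem_torusFinAdelic_of_le M Φ E hE u⟩) ∈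
        principalLevelSubgroup δ N := by
  -- the reflex norm as a continuous homomorphism into the torus `T₀(M)(𝔸_f)`
  let ψ : (FiniteAdeleRing (𝓞 ↥E) ↥E)ˣ →* ↥(torusFinAdelic M) :=
    (reflexNormFiniteIdele M Φ E).codRestrict (torusFinAdelic M) (reflexNormFiniteIdele_mem_torusFinAdelic_of_le M Φ E hE)
  have hψ : Continuous ψ := (continuous_reflexNormFiniteIdele M Φ E).subtype_mk _
  -- the open subgroup `{u | (1, N_Φ(u)) ∈ K̃_V(N)}`
  let U : Subgroup (FiniteAdeleRing (𝓞 ↥E) ↥E)ˣ := (auxLevelV Fr N).comap ((MonoidHom.inr _ _).comp ψ)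
  have hU : IsOpen (U : Set (FiniteAdeleRing (𝓞 ↥E) ↥E)ˣ) :=
    (isOpen_setOf_one_mk_mem_auxLevelV Fr hN).preimage hψ
  obtain ⟨𝔪, h𝔪, hle⟩ := IdeleAction.exists_congruenceUnits_le_of_isOpen U hU
  exact ⟨𝔪, h𝔪, fun u hu => hle hu⟩

end Conductor

end AuxV

end UnitaryCurve

/-! ### §2. The slice field: over the ray class field `C_𝔪(E)` every `σ` has an Artin correspondent in `W_𝔪` -/

namespace UnitaryCanonicalModel

open Literature.NumberTheory.GaloisRepresentations Literature.NumberTheory.NumberFields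
open Literature.NumberTheory.ComplexMultiplication (exists_absoluteGaloisGroup_comp_eq)

/-- **THE SLICE FIELD OF A CONDUCTOR.**  For a number field `E ⊆ ℂ` and an ideal `𝔪` of `𝓞_E` there is a number field `E₀ ⊆ ℂ` containing
`E` (namely `E₀ = ` the image in `ℂ` of the RAY CLASS FIELD `C_𝔪(E) ⊆ Ē`, ★ `rayClassField`, [NeukirchANT1999] VI (6.2)) such that for every
`σ ∈ Aut(ℂ)` fixing `E₀` pointwise, EVERY Artin correspondent `s` of `σ` over `E` ([Milne2005ShimuraVarieties] (59), ★ `IsArtinCorrespondent`)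
lies in `E^× · W_𝔪`: the restriction `γ ∈ Gal(Ē/E)` of `σ` fixes `C_𝔪` (two `E`-embeddings `Ē → ℂ` differ by `Gal(Ē/E)` and `C_𝔪/E` is
normal), so `[(1,s), E]|_{C_𝔪} = 1`, i.e. `(1,s) ∈ E^×·W_𝔪` ([NeukirchANT1999] VI (7.1): `G(C_𝔪|E) ≅ 𝕀_E/E^×W_𝔪`; ★
`abRestrict_ideleArtinMap_rayClassField_eq_one_iff`, ★ `mem_principalIdeles_sup_rayUnitIdeles_iff`).
[cite: NeukirchANT1999, Ch. VI §6 Def. (6.2) and §7 Thm. (7.1)] [cite: Milne2005ShimuraVarieties, (59) p. 107] [cite: Shimura1998, §18.6 proof p. 128] -/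
theorem exists_sliceField_forall_isArtinCorrespondent_mem (E : IntermediateField ℚ ℂ) [NumberField ↥E] (𝔪 : Ideal (𝓞 ↥E)) :
    ∃ E₀ : IntermediateField ℚ ℂ, FiniteDimensional ℚ ↥E₀ ∧ E ≤ E₀ ∧
      ∀ σ : ℂ ≃ₐ[ℚ] ℂ, (∀ x : ℂ, x ∈ E₀ → σ x = x) →
        ∀ s : (FiniteAdeleRing (𝓞 ↥E) ↥E)ˣ, IsArtinCorrespondent ↥E (algebraMap ↥E ℂ) s σ.toRingEquiv →
          s ∈ (FiniteAdeleRing.unitEmbedding (𝓞 ↥E) ↥E).range ⊔ IdeleAction.congruenceUnits (K := ↥E) 𝔪 := by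
  classical
  -- the compositum of all images in `ℂ` of the ray class field `C_𝔪 ⊆ Ē`
  set C : IntermediateField ↥E (AlgebraicClosure ↥E) := rayClassField ↥E 𝔪 with hC
  let E₀' : IntermediateField ↥E ℂ := IntermediateField.normalClosure ↥E ↥C ℂ
  haveI hfin' : FiniteDimensional ↥E ↥E₀' := normalClosure.is_finiteDimensional ↥E ↥C ℂ
  haveI : FiniteDimensional ℚ ↥E := inferInstance
  haveI hfinQ : FiniteDimensional ℚ ↥E₀' := Module.Finite.trans ↥E ↥E₀'
  refine ⟨E₀'.restrictScalars ℚ, hfinQ, ?_, ?_⟩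
  · intro x hx
    exact E₀'.algebraMap_mem ⟨x, hx⟩
  · intro σ hσ s hs
    obtain ⟨e₁, γ, hγσ, hγ⟩ := hs
    -- `γ` fixes `C` pointwise: `e₁` maps `C` into `E₀`, which `σ` fixes
    have hfix : ∀ y : ↥C, Field.absoluteGaloisGroup.toAlgEquiv ↥E γ (y : AlgebraicClosure ↥E) = y := by
      intro y
      have hy₀ : e₁ (y : AlgebraicClosure ↥E) ∈ E₀' :=
        AlgHom.fieldRange_le_normalClosure (e₁.comp C.val) ⟨y, rfl⟩
      have h1 : σ.toRingEquiv (e₁ (y : AlgebraicClosure ↥E)) = e₁ (y : AlgebraicClosure ↥E) := hσ _ hy₀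
      rw [← hγσ] at h1
      exact e₁.injective h1
    have hres : absRestrictNormalHom C γ = 1 := by
      apply AlgEquiv.ext
      intro y
      apply Subtype.ext
      have hc := AlgEquiv.restrictNormal_commutes (Field.absoluteGaloisGroup.toAlgEquiv ↥E γ) ↥C y
      change (((Field.absoluteGaloisGroup.toAlgEquiv ↥E γ).restrictNormal ↥C y : ↥C) : AlgebraicClosure ↥E) =
        Field.absoluteGaloisGroup.toAlgEquiv ↥E γ (y : AlgebraicClosure ↥E) at hc
      rw [hfix y] at hc
      rw [AlgEquiv.one_apply]
      exact hc
    -- hence `[(1,s), E]|_{C_𝔪} = 1`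
    have hθ : (isGlobalReciprocitySystem_artinMap ↥E).theta (finiteIdeleClass ↥E s) =
        ideleArtinMap ↥E (Units.map (MonoidHom.inr (InfiniteAdeleRing ↥E) (FiniteAdeleRing (𝓞 ↥E) ↥E) :
          FiniteAdeleRing (𝓞 ↥E) ↥E →* AdeleRing (𝓞 ↥E) ↥E) s) := by
      rw [finiteIdeleClass, ← ideleArtinMap_apply]
    have hab : abRestrict C (ideleArtinMap ↥E (Units.map (MonoidHom.inr (InfiniteAdeleRing ↥E) (FiniteAdeleRing (𝓞 ↥E) ↥E) :
          FiniteAdeleRing (𝓞 ↥E) ↥E →* AdeleRing (𝓞 ↥E) ↥E) s)) = 1 := by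
      have h := abRestrict_absGaloisAbProj C γ
      rw [hres, hγ, hθ, map_inv, inv_eq_one] at h
      exact h
    have hmem := (abRestrict_ideleArtinMap_rayClassField_eq_one_iff (Units.map (MonoidHom.inr (InfiniteAdeleRing ↥E)
      (FiniteAdeleRing (𝓞 ↥E) ↥E) : FiniteAdeleRing (𝓞 ↥E) ↥E →* AdeleRing (𝓞 ↥E) ↥E) s)).1 hab
    -- read on the finite part: `s = (x)_f · w_f` with `w_f ∈ W_𝔪`
    obtain ⟨a, ⟨x, rfl⟩, w, hw, haw⟩ := Subgroup.mem_sup.1 hmem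
    have hfp : IdeleAction.finitePart ↥E (Units.map (MonoidHom.inr (InfiniteAdeleRing ↥E) (FiniteAdeleRing (𝓞 ↥E) ↥E) :
        FiniteAdeleRing (𝓞 ↥E) ↥E →* AdeleRing (𝓞 ↥E) ↥E) s) = s := Units.ext rfl
    have hw' : IdeleAction.finitePart ↥E w ∈ IdeleAction.congruenceUnits (K := ↥E) 𝔪 := by
      rw [rayUnitIdeles_eq_comap] at hw
      exact hw
    have hx' : IdeleAction.finitePart ↥E (Units.map (algebraMap ↥E (AdeleRing (𝓞 ↥E) ↥E) : ↥E →* AdeleRing (𝓞 ↥E) ↥E) x) =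
        FiniteAdeleRing.unitEmbedding (𝓞 ↥E) ↥E x := Units.ext rfl
    rw [← hfp, ← haw, map_mul, hx']
    exact Subgroup.mul_mem_sup ⟨x, rfl⟩ hw'

/-- **Corollary: over the slice field every `σ` has an Artin correspondent INSIDE `W_𝔪`** — write a correspondent `s = (x)·u` and divide by
the principal `(x)` (§0: `E` is totally complex). [cite: NeukirchANT1999, Ch. VI §7 Thm. (7.1)] [cite: Milne2005ShimuraVarieties, (59) p. 107] -/
theorem exists_sliceField_forall_exists_isArtinCorrespondent_mem (E : IntermediateField ℚ ℂ) [NumberField ↥E] [IsTotallyComplex ↥E]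
    (𝔪 : Ideal (𝓞 ↥E)) :
    ∃ E₀ : IntermediateField ℚ ℂ, FiniteDimensional ℚ ↥E₀ ∧ E ≤ E₀ ∧
      ∀ σ : ℂ ≃ₐ[ℚ] ℂ, (∀ x : ℂ, x ∈ E₀ → σ x = x) →
        ∀ s : (FiniteAdeleRing (𝓞 ↥E) ↥E)ˣ, IsArtinCorrespondent ↥E (algebraMap ↥E ℂ) s σ.toRingEquiv →
          ∃ u : (FiniteAdeleRing (𝓞 ↥E) ↥E)ˣ, u ∈ IdeleAction.congruenceUnits (K := ↥E) 𝔪 ∧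
            IsArtinCorrespondent ↥E (algebraMap ↥E ℂ) u σ.toRingEquiv := by
  obtain ⟨E₀, hfd, hle, h⟩ := exists_sliceField_forall_isArtinCorrespondent_mem E 𝔪
  refine ⟨E₀, hfd, hle, fun σ hσ s hs => ?_⟩
  obtain ⟨y, ⟨x, rfl⟩, u, hu, hyu⟩ := Subgroup.mem_sup.1 (h σ hσ s hs)
  refine ⟨u, hu, ?_⟩
  have hu' : u = s * (FiniteAdeleRing.unitEmbedding (𝓞 ↥E) ↥E x)⁻¹ := by
    rw [← hyu, mul_inv_cancel_comm]
  rw [hu']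
  exact hs.mul_unitEmbedding_inv ↥E (algebraMap ↥E ℂ) x

end UnitaryCanonicalModel

/-! ### §3. HEAD: the Siegel reciprocity datum of a special point of the curve, over the slice field -/

namespace UnitaryCurve

namespace AuxV

open Literature.AlgebraicGeometry.ModuliOfAbelianVarieties
open Literature.NumberTheory.ComplexMultiplication (traceField reflexNormFiniteIdele)
open Literature.AlgebraicGeometry.Motives (CMType)
open Literature.NumberTheory.Automorphic Literature.NumberTheory.Automorphic.UnitaryGroup
open Literature.NumberTheory.AdelicBaseChange (finiteIdeleRelNorm)
open Literature.NumberTheory.NumberFields (IdeleAction.congruenceUnits)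
open Literature.AlgebraicGeometry.ShimuraVarieties.UnitaryCanonicalModel (IsArtinCorrespondent recipFactor IsDiagTwistGS ShimuraSetGS
  exists_isDiagTwistGS_recipFactor' conj_apply_eq_of_transpose_map_eq hermForm_conj_symm
  shimuraSetGS_mk_twist_eq_of_isArtinCorrespondent' exists_sliceField_forall_exists_isArtinCorrespondent_mem)
open Literature.AlgebraicGeometry.ShimuraVarieties.UnitaryCanonicalModel.Aux (torusFinAdelic reflexField numberField_reflexField
  toReflexField traceField_le_reflexField apply_mem_reflexField reflexNormFiniteIdele_mem_torusFinAdelic_of_le isTotallyComplex_reflexField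
  artinSurjectiveReflex isArtinCorrespondent_finiteIdeleRelNorm exists_cmType_swap traceField_le_of_swap reflexNormFiniteIdele_swap_recipFactor
  ratBasis)

section Head

variable {F : Type} [Field F] [NumberField F] [IsCMField F]

omit [NumberField F] [IsCMField F] in
/-- The Gram entries of a frame: `(ᵗc(b)·J·b)_{ik} = ⟨b e_i, b e_k⟩_J`. [cite: Deligne1979ShimuraVarieties, 2.3.9 (PDF p. 32)] -/
private theorem transpose_map_mul_mul_apply (c : F →+* F) (J b : Matrix (Fin 2) (Fin 2) F) (i k : Fin 2) :
    ((b.map c)ᵀ * J * b) i k = hermForm c J (fun l => b l i) (fun l => b l k) := by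
  simp only [Matrix.mul_apply, Matrix.transpose_apply, Matrix.map_apply, hermForm, dotProduct, Matrix.mulVec,
    Function.comp_apply, Finset.sum_mul, Finset.mul_sum, mul_assoc]
  rw [Finset.sum_comm]

/-- **E3R HEAD, PINNED EDITION (ED. 3) — THE SIEGEL RECIPROCITY DATUM WITH ITS CM STRUCTURE PINNED ON THE FRAME.**  Same as ED. 2
`exists_sliceField_siegelRecipDatum_explicit` (below), with ONE conjunct more about the CM structure `c` of the datum: **`c.actMatrix (x, x) =
P_Fr · res(x • 1₂) · Q_Fr` for every `x ∈ F`** (★ FILE A `actMatrix_eq_frame_of_pinnedV` at constant tuples: the frame structure of `B = (w′ | w)` acts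
by `B · diag(x₀, x₁) · B⁻¹`, and `B · diag(x, x) · B⁻¹ = x • 1`) — i.e. the DIAGONAL `F ⊂ F × F` acts through `c` by the scalar multiplication of
`V = F²` read in the symplectic frame `Fr`, which is LITERALLY the rational frame reading `ρ(b) = P_Fr · res(b • 1) · Q_Fr` of the `𝒪_F`-action in the
E-line chart (★ `UnitaryCurve.AuxV.exists_chartActionReading_frame`, hypothesis `hρ`; field `AuxChartGS.Mρ_frame`).  WHY THE CONSUMER NEEDS IT
(Σ-GAL half of `stub_E6`): the `hlin` hypothesis of ★ (K-c) `adelicCongr_mulVec_of_frame` asks the re-indexing element `g₀ = r` (ED. 2, ★ (K-b)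
`mover_mul_reindex_mul_mover_inv_eq`) to commute with `ρ(b)_𝔸`; `r` has matrix `c.cmRecipMatrix Φ′ E s♯`, which commutes with every `c.actMatrix x`
(★ `CMStructure.cmRecipMatrix_mul_adelicMatrix_actMatrix_comm`), and this conjunct identifies `ρ(b)` with `c.actMatrix (b, b)`.  Without it the
`c` of the datum is only known up to `IsSpecial`, which does not determine its action.  Proof: ED. 2 verbatim plus the pin.
[cite: Deligne1971TravauxShimura, 4.18 p. 150 and 5.11 p. 158] [cite: Milne2005ShimuraVarieties, Def. 12.8 (59)–(62) p. 114, §11 Thm. 11.2 p. 108]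
[cite: RapoportSmithlingZhang2020Diagonal, Remark 3.1 p. 9, (3.3), (3.10)] [cite: NeukirchANT1999, Ch. VI §6 (6.2), §7 (7.1)] -/
theorem exists_sliceField_siegelRecipDatum_pinned (ι₁ : F →+* ℂ) (Jstar : Matrix (Fin 2) (Fin 2) F)
    (hJ : (Jstar.map (IsCMField.complexConj F))ᵀ = Jstar) (Φ : CMType F) (hΦ : ι₁ ∈ Φ.1) {ξ : F} {g N : ℕ} {δ : Fin g → ℕ}
    (hN : N ≠ 0) (Fr : SymplecticFrameV F (RingHom.id F) Jstar ξ g δ)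
    (J : (Fin 2 → ℂ) → Matrix (Fin g ⊕ Fin g) (Fin g ⊕ Fin g) ℝ)
    (hJC : ∀ v : Fin 2 → ℂ, v ∈ negCone (Jstar.map ι₁) → J v ∈ C0pm δ)
    (hJsp : ∀ (w : Fin 2 → F) (hw : (fun i => ι₁ (w i)) ∈ negCone (Jstar.map ι₁)) (b : GL (Fin 2) F),
      (fun i => (b : Matrix (Fin 2) (Fin 2) F) i 1) = w →
      hermForm (cmConjRingHom F) Jstar (fun i => (b : Matrix (Fin 2) (Fin 2) F) i 0) w = 0 →
      ∀ c : CMStructure g δ (Fin 2) (fun _ => F),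
        (∀ (x : Fin 2 → F) (p : Fin 2) (m : F),
          c.act x (Fr.β (m • (b : Matrix (Fin 2) (Fin 2) F) *ᵥ Pi.single p 1)) =
            Fr.β ((x p * m) • (b : Matrix (Fin 2) (Fin 2) F) *ᵥ Pi.single p 1)) →
        ∀ Φ' : Fin 2 → CMType F, Φ' 0 = Φ →
          (∀ ρ : F →+* ℂ, ρ ∈ (Φ' 1).1 ↔ (ρ ∈ Φ.1 ∧ ρ ≠ ι₁) ∨ ρ = NumberField.ComplexEmbedding.conjugate ι₁) →
          c.IsSpecial ⟨J (fun i => ι₁ (w i)), hJC _ hw⟩ Φ') :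
    ∃ E₀ : IntermediateField ℚ ℂ, FiniteDimensional ℚ ↥E₀ ∧ (∀ x : F, ι₁ x ∈ E₀) ∧
      ∀ σ : ℂ ≃ₐ[ℚ] ℂ, (∀ x : ℂ, x ∈ E₀ → σ x = x) →
      ∀ s : (FiniteAdeleRing (𝓞 F) F)ˣ, IsArtinCorrespondent F ι₁ s σ.toRingEquiv →
      ∀ (w : Fin 2 → F) (hw : (fun i => ι₁ (w i)) ∈ negCone (Jstar.map ι₁))
        (d : ↥(finAdelic (↥(maximalRealSubfield F)) F (IsCMField.complexConj F) 2 Jstar)),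
        IsDiagTwistGS F Jstar w (recipFactor F s) d →
      ∀ a : ↥(finAdelic (↥(maximalRealSubfield F)) F (IsCMField.complexConj F) 2 Jstar),
        ∃ (E : IntermediateField ℚ ℂ) (_ : NumberField ↥E) (c : CMStructure g δ (Fin 2) (fun _ => F)) (Φ' : Fin 2 → CMType F)
          (sE : (FiniteAdeleRing (𝓞 ↥E) ↥E)ˣ) (r : ↥(gspFinAdelic δ))
          (d' : ↥(finAdelic (↥(maximalRealSubfield F)) F (IsCMField.complexConj F) 2 Jstar)),
          c.IsSpecial ⟨J (fun i => ι₁ (w i)), hJC _ hw⟩ Φ' ∧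
          (∀ x : F, c.actMatrix (fun _ => x) = framePV Fr * resMatrix (ratBasis F) (x • (1 : Matrix (Fin 2) (Fin 2) F)) * frameQV Fr) ∧
          (∀ i, traceField (Φ' i) ≤ E) ∧ E ≤ E₀ ∧
          IsArtinCorrespondent ↥E (algebraMap ↥E ℂ) sE σ.toRingEquiv ∧
          ((r : GL (Fin g ⊕ Fin g) finAdeleQ) : Matrix (Fin g ⊕ Fin g) (Fin g ⊕ Fin g) finAdeleQ) = c.cmRecipMatrix Φ' E sE ∧
          (∃ t ∈ principalLevelSubgroup δ N, r * auxToGspFinV Fr (a, 1) = auxToGspFinV Fr (d' * a, 1) * t) ∧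
          ∀ K : Subgroup ↥(finAdelic (↥(maximalRealSubfield F)) F (IsCMField.complexConj F) 2 Jstar),
            ShimuraSetGS.mk F Jstar ι₁ K (fun i => ι₁ (w i)) hw (d * a) = ShimuraSetGS.mk F Jstar ι₁ K (fun i => ι₁ (w i)) hw (d' * a) := by
  classical
  -- the reflex compositum `E♯ = ι₁(F)·E*(Φ)` and the swapped type `Ψ = Φ^ῑ₁`
  haveI : NumberField ↥(reflexField F Φ ι₁) := numberField_reflexField F Φ ι₁
  haveI : IsTotallyComplex ↥(reflexField F Φ ι₁) := isTotallyComplex_reflexField F Φ ι₁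
  letI : Algebra F ↥(reflexField F Φ ι₁) := (toReflexField F Φ ι₁).toAlgebra
  have hEΦ : traceField Φ ≤ reflexField F Φ ι₁ := traceField_le_reflexField F Φ ι₁
  have hι₁ : NumberField.ComplexEmbedding.conjugate ι₁ ≠ ι₁ := fun h =>
    NumberField.IsTotallyComplex.complexEmbedding_not_isReal ι₁ (NumberField.ComplexEmbedding.isReal_iff.mpr h)
  obtain ⟨Ψ, hΨ⟩ := exists_cmType_swap Φ ι₁ (RingHom.id F) hι₁
  have hΨE : traceField Ψ ≤ reflexField F Φ ι₁ :=
    traceField_le_of_swap Φ Ψ ι₁ (RingHom.id F) hΨ (reflexField F Φ ι₁) (apply_mem_reflexField F Φ ι₁) hEΦ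
  have hJ' : ∀ i k, cmConjRingHom F (Jstar i k) = Jstar k i := conj_apply_eq_of_transpose_map_eq F Jstar hJ
  -- the conductor and the slice field
  obtain ⟨𝔪, -, hcond⟩ := exists_conductor_one_mk_reflexNorm_mem Fr Φ (reflexField F Φ ι₁) hEΦ hN
  obtain ⟨E₀, hfd, hEE₀, hslice⟩ := exists_sliceField_forall_exists_isArtinCorrespondent_mem (reflexField F Φ ι₁) 𝔪
  refine ⟨E₀, hfd, fun x => hEE₀ (apply_mem_reflexField F Φ ι₁ x), ?_⟩
  intro σ hσ s hs w hw d hd a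
  -- an Artin correspondent of `σ` over `E♯` INSIDE `W_𝔪`, and its norm to `F`
  have hσE : ∀ x : ↥(reflexField F Φ ι₁), σ.toRingEquiv (algebraMap ↥(reflexField F Φ ι₁) ℂ x) =
      algebraMap ↥(reflexField F Φ ι₁) ℂ x := fun x => hσ _ (hEE₀ x.2)
  obtain ⟨s₀, hs₀⟩ := artinSurjectiveReflex F Φ ι₁ σ.toRingEquiv hσE
  obtain ⟨u, hu, hus⟩ := hslice σ hσ s₀ hs₀
  have hNu : IsArtinCorrespondent F ι₁ (finiteIdeleRelNorm F ↥(reflexField F Φ ι₁) u) σ.toRingEquiv :=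
    isArtinCorrespondent_finiteIdeleRelNorm F Φ ι₁ σ.toRingEquiv u hus
  -- the twist `d♯` by `r_w(N u)` and the frame `b = (w′ | w)`
  have hww : hermForm (cmConjRingHom F) Jstar w w ≠ 0 :=
    UnitaryCanonicalModel.hermForm_self_ne_zero_of_embedding_mem_negCone hw
  obtain ⟨d', hd'⟩ := exists_isDiagTwistGS_recipFactor' F Jstar hJ hww (finiteIdeleRelNorm F ↥(reflexField F Φ ι₁) u)
  have hsymm : ∀ x y : Fin 2 → F, hermForm (cmConjRingHom F) Jstar x y = 0 → hermForm (cmConjRingHom F) Jstar y x = 0 := by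
    intro x y hxy
    rw [hermForm_conj_symm F Jstar hJ', hxy, map_zero]
  obtain ⟨-, b₀, -, hb1₀, hperp₀, -⟩ :=
    exists_frame_formCongr_eq_finSum_of_hermForm_self_ne_zero (cmConjRingHom F) (n := 1) Jstar hsymm w hww
  have key : ∃ b : GL (Fin 2) F, (fun i => (b : Matrix (Fin 2) (Fin 2) F) i 1) = w ∧
      hermForm (cmConjRingHom F) Jstar (fun i => (b : Matrix (Fin 2) (Fin 2) F) i 0) w = 0 :=
    ⟨b₀, funext fun i => hb1₀ i, hsymm _ _ (hperp₀ 0)⟩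
  obtain ⟨b, hb1', hperp⟩ := key
  have hperp0 : hermForm (cmConjRingHom F) Jstar w (fun i => (b : Matrix (Fin 2) (Fin 2) F) i 0) = 0 := hsymm _ _ hperp
  have hJid : Jstar.map (RingHom.id F) = Jstar := by
    ext i k
    rfl
  -- the CM structure of the frame (FILE A) and the special pair (E2, by value)
  have hB : ∀ i k : Fin 2, i ≠ k →
      (((b : Matrix (Fin 2) (Fin 2) F).map (IsCMField.complexConj F))ᵀ * Jstar.map (RingHom.id F) *
        (b : Matrix (Fin 2) (Fin 2) F)) i k = 0 := by
    intro i k hik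
    rw [hJid]
    change (((b : Matrix (Fin 2) (Fin 2) F).map (cmConjRingHom F))ᵀ * Jstar * (b : Matrix (Fin 2) (Fin 2) F)) i k = 0
    rw [transpose_map_mul_mul_apply]
    fin_cases i <;> fin_cases k
    · exact absurd rfl hik
    · change hermForm (cmConjRingHom F) Jstar (fun l => (b : Matrix (Fin 2) (Fin 2) F) l 0)
          (fun l => (b : Matrix (Fin 2) (Fin 2) F) l 1) = 0
      rw [hb1']; exact hperp
    · change hermForm (cmConjRingHom F) Jstar (fun l => (b : Matrix (Fin 2) (Fin 2) F) l 1)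
          (fun l => (b : Matrix (Fin 2) (Fin 2) F) l 0) = 0
      rw [hb1']; exact hperp0
    · exact absurd rfl hik
  obtain ⟨c, hc⟩ := exists_cmStructureV_of_orthogonal Fr b hB
  let Φ' : Fin 2 → CMType F := ![Φ, Ψ]
  have hΦ'0 : Φ' 0 = Φ := rfl
  have hΦ'1 : Φ' 1 = Ψ := rfl
  have hΨ' : ∀ ρ : F →+* ℂ, ρ ∈ (Φ' 1).1 ↔ (ρ ∈ Φ.1 ∧ ρ ≠ ι₁) ∨ ρ = NumberField.ComplexEmbedding.conjugate ι₁ := by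
    intro ρ
    rw [hΦ'1, hΨ ρ, RingHom.comp_id]
  have hsp : c.IsSpecial ⟨J (fun i => ι₁ (w i)), hJC _ hw⟩ Φ' := hJsp w hw b hb1' hperp c hc Φ' hΦ'0 hΨ'
  -- the torus element `t = N_{E♯,Φ}(u)` and the reciprocity element `r = ũ_V(d♯, t)`
  let t : ↥(torusFinAdelic F) :=
    ⟨reflexNormFiniteIdele F Φ (reflexField F Φ ι₁) u, reflexNormFiniteIdele_mem_torusFinAdelic_of_le F Φ (reflexField F Φ ι₁) hEΦ u⟩
  have hbmap : Matrix.GeneralLinearGroup.map (RingHom.id F) b = b := by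
    ext i k
    rfl
  have hact : ∀ x : Fin 2 → F, c.actMatrix x =
      framePV Fr * resMatrix (ratBasis F)
        (((Matrix.GeneralLinearGroup.map (RingHom.id F) b : GL (Fin 2) F) : Matrix (Fin 2) (Fin 2) F) * Matrix.diagonal x *
          (((Matrix.GeneralLinearGroup.map (RingHom.id F) b)⁻¹ : GL (Fin 2) F) : Matrix (Fin 2) (Fin 2) F)) * frameQV Fr := by
    intro x
    rw [hbmap]
    exact actMatrix_eq_frame_of_pinnedV Fr b c hc x
  -- the structure is PINNED on the frame: a constant tuple acts by the scalar `x • 1` read through `Fr`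
  have hpin : ∀ x : F, c.actMatrix (fun _ => x) =
      framePV Fr * resMatrix (ratBasis F) (x • (1 : Matrix (Fin 2) (Fin 2) F)) * frameQV Fr := by
    intro x
    rw [hact]
    congr 2
    have hdiag : (Matrix.diagonal fun _ : Fin 2 => x) = x • (1 : Matrix (Fin 2) (Fin 2) F) := by
      ext i k
      by_cases hik : i = k
      · subst hik; simp
      · simp [Matrix.one_apply_ne hik, hik]
    rw [hdiag, Matrix.mul_smul, Matrix.mul_one, Matrix.smul_mul, ← Units.val_mul, mul_inv_cancel, Units.val_one]
  have hN₀ : ((reflexNormFiniteIdele F (Φ' 0) (reflexField F Φ ι₁) u : (FiniteAdeleRing (𝓞 F) F)ˣ) : FiniteAdeleRing (𝓞 F) F) =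
      ((t : (FiniteAdeleRing (𝓞 F) F)ˣ) : FiniteAdeleRing (𝓞 F) F) := rfl
  have hN₁ : ((reflexNormFiniteIdele F (Φ' 1) (reflexField F Φ ι₁) u : (FiniteAdeleRing (𝓞 F) F)ˣ) : FiniteAdeleRing (𝓞 F) F) =
      ((t : (FiniteAdeleRing (𝓞 F) F)ˣ) : FiniteAdeleRing (𝓞 F) F) *
        Literature.NumberTheory.ComplexMultiplication.ratFiniteAdeleTensorEquiv F
          (Literature.AlgebraicGeometry.ShimuraVarieties.UnitaryCanonicalModel.Aux.finAdeleToTensor F (RingHom.id F)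
            (recipFactor F (finiteIdeleRelNorm F ↥(reflexField F Φ ι₁) u))) := by
    rw [hΦ'1]
    exact reflexNormFiniteIdele_swap_recipFactor F (RingHom.id F) Φ Ψ (reflexField F Φ ι₁) ι₁ (fun x => rfl) hEΦ hΨE
      (fun ρ hρ => by rw [RingHom.comp_id] at hρ; rw [hρ]; exact hΦ) hΨ u
  have hr : ((auxToGspFinV Fr (d', t) : GL (Fin g ⊕ Fin g) finAdeleQ) : Matrix (Fin g ⊕ Fin g) (Fin g ⊕ Fin g) finAdeleQ) =
      c.cmRecipMatrix Φ' (reflexField F Φ ι₁) u :=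
    coe_auxToGspFinV_eq_cmRecipMatrix_of_isDiagTwistGS Fr b hb1' hperp c hact hd' t Φ' (reflexField F Φ ι₁) u hN₀ hN₁
  -- the scalar `ũ_V(1, t)` lies in `K_δ(N)` and is central: it dies on the right
  have ht : auxToGspFinV Fr (1, t) ∈ principalLevelSubgroup δ N := hcond u hu
  have hsplit : auxToGspFinV Fr (d', t) * auxToGspFinV Fr (a, 1) = auxToGspFinV Fr (d' * a, 1) * auxToGspFinV Fr (1, t) := by
    rw [← map_mul, Prod.mk_mul_mk, mul_one, auxToGspFinV_eq_mul, auxToGspFinV_one_mul_comm_one]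
  -- the two twist classes on the curve agree (FILE D)
  have hGS : ∀ K : Subgroup ↥(finAdelic (↥(maximalRealSubfield F)) F (IsCMField.complexConj F) 2 Jstar),
      ShimuraSetGS.mk F Jstar ι₁ K (fun i => ι₁ (w i)) hw (d * a) = ShimuraSetGS.mk F Jstar ι₁ K (fun i => ι₁ (w i)) hw (d' * a) :=
    fun K => shimuraSetGS_mk_twist_eq_of_isArtinCorrespondent' F Jstar hJ ι₁ K hs hNu hww hw hd hd' a
  refine ⟨reflexField F Φ ι₁, inferInstance, c, Φ', u, auxToGspFinV Fr (d', t), d', hsp, hpin, ?_, hEE₀, hus, hr,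
    ⟨auxToGspFinV Fr (1, t), ht, hsplit⟩, hGS⟩
  intro i
  fin_cases i
  · exact hEΦ
  · exact hΨE

/-- **E3R HEAD, EXPLICIT EDITION (ED. 2) — THE SIEGEL RECIPROCITY DATUM WITH THE TWIST IDENTITY ON THE NOSE.**  Same data and conclusion as
`exists_sliceField_siegelRecipDatum` (below), except that the Siegel-side class identity `[J(ι₁w), r·ũ_V(a,1)]_{K_δ(N)} = [J(ι₁w), ũ_V(d♯·a,1)]_{K_δ(N)}` is
exported in the EXPLICIT adelic form its proof actually establishes: **`r · ũ_V(a,1) = ũ_V(d♯·a,1) · t` for some `t ∈ K_δ(N)`** (`t = ũ_V(1, N_Φ(s♯))`, the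
central scalar of §1, ★ `exists_conductor_one_mk_reflexNorm_mem`) — i.e. the Shimura-set identity holds with RATIONAL WITNESS `γ = 1` ([Milne2005ShimuraVarieties]
Lemma 5.13 «`a = qgk`» with `q = 1`).  WHY THE CONSUMER NEEDS IT (Σ-GAL half of the E-line socket `stub_E6`, organs ★ (K-b) `SiegelConjugationHomReindex` ∕
★ (K-c) `SiegelAdelicCongrFrameTransport`): the rational witness `γ` of this identity enters the re-indexing element `g₀ = γ̂⁻¹ · r` whose commutation with the
adelised `𝒪_F`-action is the `hlin` hypothesis of ★ `adelicCongr_mulVec_of_frame`; a witness merely unpacked from ★ `SiegelShimuraSet.mk_eq_mk_iff` lies in the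
stabiliser of `J(ι₁w)` in `GSp_δ(ℚ)` and need not commute with the `𝒪_F`-action (when `F` is not central in `End⁰` of the special fibre), whereas `γ = 1` gives
`g₀ = r`, of matrix `c.cmRecipMatrix Φ′ E s♯`, which does.  Proof: the proof of ED. 1 verbatim, keeping `hsplit` ∕ `ht` instead of folding them into
★ `SiegelShimuraSet.mk_mul_of_mem`.
[cite: Milne2005ShimuraVarieties, §5 Lemma 5.13 p. 57, Def. 12.8 (59)–(62) p. 114, Ex. 12.4 (b) p. 112] [cite: Deligne1971TravauxShimura, 4.18 p. 150 and 5.11 p. 158]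
[cite: RapoportSmithlingZhang2020Diagonal, Remark 3.1 p. 9, (3.3), (3.10)] [cite: NeukirchANT1999, Ch. VI §6 (6.2), §7 (7.1)] -/
theorem exists_sliceField_siegelRecipDatum_explicit (ι₁ : F →+* ℂ) (Jstar : Matrix (Fin 2) (Fin 2) F)
    (hJ : (Jstar.map (IsCMField.complexConj F))ᵀ = Jstar) (Φ : CMType F) (hΦ : ι₁ ∈ Φ.1) {ξ : F} {g N : ℕ} {δ : Fin g → ℕ}
    (hN : N ≠ 0) (Fr : SymplecticFrameV F (RingHom.id F) Jstar ξ g δ)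
    (J : (Fin 2 → ℂ) → Matrix (Fin g ⊕ Fin g) (Fin g ⊕ Fin g) ℝ)
    (hJC : ∀ v : Fin 2 → ℂ, v ∈ negCone (Jstar.map ι₁) → J v ∈ C0pm δ)
    (hJsp : ∀ (w : Fin 2 → F) (hw : (fun i => ι₁ (w i)) ∈ negCone (Jstar.map ι₁)) (b : GL (Fin 2) F),
      (fun i => (b : Matrix (Fin 2) (Fin 2) F) i 1) = w →
      hermForm (cmConjRingHom F) Jstar (fun i => (b : Matrix (Fin 2) (Fin 2) F) i 0) w = 0 →
      ∀ c : CMStructure g δ (Fin 2) (fun _ => F),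
        (∀ (x : Fin 2 → F) (p : Fin 2) (m : F),
          c.act x (Fr.β (m • (b : Matrix (Fin 2) (Fin 2) F) *ᵥ Pi.single p 1)) =
            Fr.β ((x p * m) • (b : Matrix (Fin 2) (Fin 2) F) *ᵥ Pi.single p 1)) →
        ∀ Φ' : Fin 2 → CMType F, Φ' 0 = Φ →
          (∀ ρ : F →+* ℂ, ρ ∈ (Φ' 1).1 ↔ (ρ ∈ Φ.1 ∧ ρ ≠ ι₁) ∨ ρ = NumberField.ComplexEmbedding.conjugate ι₁) →
          c.IsSpecial ⟨J (fun i => ι₁ (w i)), hJC _ hw⟩ Φ') :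
    ∃ E₀ : IntermediateField ℚ ℂ, FiniteDimensional ℚ ↥E₀ ∧ (∀ x : F, ι₁ x ∈ E₀) ∧
      ∀ σ : ℂ ≃ₐ[ℚ] ℂ, (∀ x : ℂ, x ∈ E₀ → σ x = x) →
      ∀ s : (FiniteAdeleRing (𝓞 F) F)ˣ, IsArtinCorrespondent F ι₁ s σ.toRingEquiv →
      ∀ (w : Fin 2 → F) (hw : (fun i => ι₁ (w i)) ∈ negCone (Jstar.map ι₁))
        (d : ↥(finAdelic (↥(maximalRealSubfield F)) F (IsCMField.complexConj F) 2 Jstar)),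
        IsDiagTwistGS F Jstar w (recipFactor F s) d →
      ∀ a : ↥(finAdelic (↥(maximalRealSubfield F)) F (IsCMField.complexConj F) 2 Jstar),
        ∃ (E : IntermediateField ℚ ℂ) (_ : NumberField ↥E) (c : CMStructure g δ (Fin 2) (fun _ => F)) (Φ' : Fin 2 → CMType F)
          (sE : (FiniteAdeleRing (𝓞 ↥E) ↥E)ˣ) (r : ↥(gspFinAdelic δ))
          (d' : ↥(finAdelic (↥(maximalRealSubfield F)) F (IsCMField.complexConj F) 2 Jstar)),
          c.IsSpecial ⟨J (fun i => ι₁ (w i)), hJC _ hw⟩ Φ' ∧ (∀ i, traceField (Φ' i) ≤ E) ∧ E ≤ E₀ ∧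
          IsArtinCorrespondent ↥E (algebraMap ↥E ℂ) sE σ.toRingEquiv ∧
          ((r : GL (Fin g ⊕ Fin g) finAdeleQ) : Matrix (Fin g ⊕ Fin g) (Fin g ⊕ Fin g) finAdeleQ) = c.cmRecipMatrix Φ' E sE ∧
          (∃ t ∈ principalLevelSubgroup δ N, r * auxToGspFinV Fr (a, 1) = auxToGspFinV Fr (d' * a, 1) * t) ∧
          ∀ K : Subgroup ↥(finAdelic (↥(maximalRealSubfield F)) F (IsCMField.complexConj F) 2 Jstar),
            ShimuraSetGS.mk F Jstar ι₁ K (fun i => ι₁ (w i)) hw (d * a) = ShimuraSetGS.mk F Jstar ι₁ K (fun i => ι₁ (w i)) hw (d' * a) := by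
  obtain ⟨E₀, hfd, hι₁E₀, h⟩ := exists_sliceField_siegelRecipDatum_pinned ι₁ Jstar hJ Φ hΦ hN Fr J hJC hJsp
  refine ⟨E₀, hfd, hι₁E₀, fun σ hσ s hs w hw d hd a => ?_⟩
  obtain ⟨E, hEnf, c, Φ', sE, r, d', hsp, -, hrest⟩ := h σ hσ s hs w hw d hd a
  exact ⟨E, hEnf, c, Φ', sE, r, d', hsp, hrest⟩

/-- **E3R HEAD — THE SIEGEL RECIPROCITY DATUM OF A SPECIAL POINT OF THE UNITARY SHIMURA CURVE, OVER THE SLICE FIELD.**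
Data: a CM field `F` with `ι₁ : F → ℂ`, a hermitian `J⋆ ∈ M₂(F)` (the curve datum `U(J⋆)`), a CM type `Φ ∋ ι₁`, a symplectic frame `Fr` of the
`W₀`-free module `(V_F, ψ_V) = (F², Tr(ξ·ᵗc(x)·J⋆·y))` (★ E1 `SymplecticFrameV`, `j = id`), a level `N ≥ 1`, and a family of complex structures
`J(v) ∈ S^±` on the negative cone (E2's `auxComplexStructureV`, entering BY VALUE through `hJC` and the SPECIAL-PAIR CLAUSE `hJsp`: for every
special `w ∈ F²`, frame `b = (w′ | w)` with `w′ ⟂ w`, frame CM structure `c` pinned on `b` through `Fr` (★ FILE A) and types `Φ′ = (Φ, Φ^ῑ₁)`,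
`(c, J(ι₁w))` is a CM special pair — [Deligne1971TravauxShimura] 5.11, rank-2 twin of ★ `Aux.isSpecial_of_frame_spec_of_line`).
CONCLUSION: there is a number field `E₀ ⊆ ℂ` containing `ι₁(F)` — the ray class field `C_𝔪` of the reflex compositum `E♯ = ι₁(F)·E*(Φ)` for
the conductor `𝔪 = 𝔪(N, Fr)` of §1, through §2 — such that for every `σ ∈ Aut(ℂ)` fixing `E₀`, every `F`-idèle `s` with `art_F(s) = σ|` along
`ι₁` (★ `IsArtinCorrespondent`), every special `w`, diagonal twist `d` by `r_w(s) = c(s)/s` (★ `IsDiagTwistGS`, ★ `recipFactor`) and every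
adelic `a`, there are the INPUT DATA `(E, c, Φ′, s♯, r)` of the Siegel reciprocity law (62) ★ `SiegelRationalModel.IsCanonical` — `(c, J(ι₁w))`
special with types `Φ′`, `E ⊇ E*(Φ′ᵢ)`, `E ⊆ E₀`, `s♯` an Artin correspondent of `σ` over `E ⊂ ℂ`, `r ∈ GSp_δ(𝔸_f)` with matrix `c.cmRecipMatrix Φ′ E s♯`
— together with a twist `d♯` at `w` such that `[J(ι₁w), r·ũ_V(a,1)]_{K_δ(N)} = [J(ι₁w), ũ_V(d♯·a,1)]_{K_δ(N)}` in the Siegel Shimura set and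
`[ι₁w, d·a]_K = [ι₁w, d♯·a]_K` in the curve's Shimura set at EVERY level `K`.  Proof: `E = E♯`; `s♯ ∈ W_𝔪` exists by §2 (★ `artinSurjectiveReflex`);
`d♯ = r_w(N_{E♯/F} s♯)` (★ `exists_isDiagTwistGS_recipFactor'`, ★ norm functoriality `isArtinCorrespondent_finiteIdeleRelNorm`); `r = ũ_V(d♯, N_{E♯,Φ}(s♯))`
has matrix `cmRecipMatrix` by ★ FILE B with the swap identity ★ `reflexNormFiniteIdele_swap_recipFactor`; the scalar `ũ_V(1, N_Φ(s♯)) ∈ K_δ(N)`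
(§1) is central (★ FILE B) and dies on the right; the two twist classes agree by ★ FILE D.  With the carrier reciprocity of the Siegel fine moduli
scheme (E3R-S) this is the E-line's `AuxChartGS.f_recip` over any slice field `Fᵢ ⊇ E₀` ([RapoportSmithlingZhang2020Diagonal] (3.10): the auxiliary
model lives over `E ⊇ φ₀(F)·E_Φ`, Remark 3.1 «`E` may be larger»).
[cite: Milne2005ShimuraVarieties, Def. 12.5 p. 113, Def. 12.8 (59)–(62) p. 114, Ex. 12.4 (b) p. 112] [cite: Deligne1971TravauxShimura, 4.18 p. 150 and 5.11 p. 158]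
[cite: RapoportSmithlingZhang2020Diagonal, Remark 3.1 p. 9, (3.3), (3.10)] [cite: NeukirchANT1999, Ch. VI §6 (6.2), §7 (7.1)] -/
theorem exists_sliceField_siegelRecipDatum (ι₁ : F →+* ℂ) (Jstar : Matrix (Fin 2) (Fin 2) F)
    (hJ : (Jstar.map (IsCMField.complexConj F))ᵀ = Jstar) (Φ : CMType F) (hΦ : ι₁ ∈ Φ.1) {ξ : F} {g N : ℕ} {δ : Fin g → ℕ}
    (hN : N ≠ 0) (Fr : SymplecticFrameV F (RingHom.id F) Jstar ξ g δ)
    (J : (Fin 2 → ℂ) → Matrix (Fin g ⊕ Fin g) (Fin g ⊕ Fin g) ℝ)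
    (hJC : ∀ v : Fin 2 → ℂ, v ∈ negCone (Jstar.map ι₁) → J v ∈ C0pm δ)
    (hJsp : ∀ (w : Fin 2 → F) (hw : (fun i => ι₁ (w i)) ∈ negCone (Jstar.map ι₁)) (b : GL (Fin 2) F),
      (fun i => (b : Matrix (Fin 2) (Fin 2) F) i 1) = w →
      hermForm (cmConjRingHom F) Jstar (fun i => (b : Matrix (Fin 2) (Fin 2) F) i 0) w = 0 →
      ∀ c : CMStructure g δ (Fin 2) (fun _ => F),
        (∀ (x : Fin 2 → F) (p : Fin 2) (m : F),
          c.act x (Fr.β (m • (b : Matrix (Fin 2) (Fin 2) F) *ᵥ Pi.single p 1)) =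
            Fr.β ((x p * m) • (b : Matrix (Fin 2) (Fin 2) F) *ᵥ Pi.single p 1)) →
        ∀ Φ' : Fin 2 → CMType F, Φ' 0 = Φ →
          (∀ ρ : F →+* ℂ, ρ ∈ (Φ' 1).1 ↔ (ρ ∈ Φ.1 ∧ ρ ≠ ι₁) ∨ ρ = NumberField.ComplexEmbedding.conjugate ι₁) →
          c.IsSpecial ⟨J (fun i => ι₁ (w i)), hJC _ hw⟩ Φ') :
    ∃ E₀ : IntermediateField ℚ ℂ, FiniteDimensional ℚ ↥E₀ ∧ (∀ x : F, ι₁ x ∈ E₀) ∧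
      ∀ σ : ℂ ≃ₐ[ℚ] ℂ, (∀ x : ℂ, x ∈ E₀ → σ x = x) →
      ∀ s : (FiniteAdeleRing (𝓞 F) F)ˣ, IsArtinCorrespondent F ι₁ s σ.toRingEquiv →
      ∀ (w : Fin 2 → F) (hw : (fun i => ι₁ (w i)) ∈ negCone (Jstar.map ι₁))
        (d : ↥(finAdelic (↥(maximalRealSubfield F)) F (IsCMField.complexConj F) 2 Jstar)),
        IsDiagTwistGS F Jstar w (recipFactor F s) d →
      ∀ a : ↥(finAdelic (↥(maximalRealSubfield F)) F (IsCMField.complexConj F) 2 Jstar),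
        ∃ (E : IntermediateField ℚ ℂ) (_ : NumberField ↥E) (c : CMStructure g δ (Fin 2) (fun _ => F)) (Φ' : Fin 2 → CMType F)
          (sE : (FiniteAdeleRing (𝓞 ↥E) ↥E)ˣ) (r : ↥(gspFinAdelic δ))
          (d' : ↥(finAdelic (↥(maximalRealSubfield F)) F (IsCMField.complexConj F) 2 Jstar)),
          c.IsSpecial ⟨J (fun i => ι₁ (w i)), hJC _ hw⟩ Φ' ∧ (∀ i, traceField (Φ' i) ≤ E) ∧ E ≤ E₀ ∧
          IsArtinCorrespondent ↥E (algebraMap ↥E ℂ) sE σ.toRingEquiv ∧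
          ((r : GL (Fin g ⊕ Fin g) finAdeleQ) : Matrix (Fin g ⊕ Fin g) (Fin g ⊕ Fin g) finAdeleQ) = c.cmRecipMatrix Φ' E sE ∧
          SiegelShimuraSet.mk δ (principalLevelSubgroup δ N) ⟨J (fun i => ι₁ (w i)), hJC _ hw⟩ (r * auxToGspFinV Fr (a, 1)) =
            SiegelShimuraSet.mk δ (principalLevelSubgroup δ N) ⟨J (fun i => ι₁ (w i)), hJC _ hw⟩ (auxToGspFinV Fr (d' * a, 1)) ∧
          ∀ K : Subgroup ↥(finAdelic (↥(maximalRealSubfield F)) F (IsCMField.complexConj F) 2 Jstar),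
            ShimuraSetGS.mk F Jstar ι₁ K (fun i => ι₁ (w i)) hw (d * a) = ShimuraSetGS.mk F Jstar ι₁ K (fun i => ι₁ (w i)) hw (d' * a) := by
  obtain ⟨E₀, hfd, hι₁E₀, h⟩ := exists_sliceField_siegelRecipDatum_explicit ι₁ Jstar hJ Φ hΦ hN Fr J hJC hJsp
  refine ⟨E₀, hfd, hι₁E₀, fun σ hσ s hs w hw d hd a => ?_⟩
  obtain ⟨E, hEnf, c, Φ', sE, r, d', hsp, hEΦ, hEE₀, hsE, hr, ⟨t, ht, hsplit⟩, hGS⟩ := h σ hσ s hs w hw d hd a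
  refine ⟨E, hEnf, c, Φ', sE, r, d', hsp, hEΦ, hEE₀, hsE, hr, ?_, hGS⟩
  rw [hsplit]
  exact SiegelShimuraSet.mk_mul_of_mem δ (principalLevelSubgroup δ N) _ _ ht

end Head

end AuxV

end UnitaryCurve

end Literature.AlgebraicGeometry.ShimuraVarieties

end
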